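import Literature.NumberTheory.GaloisRepresentations.GaloisSubgroups
import Mathlib.FieldTheory.Galois.Infinite
import HarnessLib

/-!
# The field cut out by an open normal subgroup of `Γ_K` (infinite Galois correspondence)

Glue for the `μ`-transfer core of BSD crux 19276 (HOME/koly/MU-TRANSFER-PROOF.md (F8), STEP 2:
"let `L₀`, `L_M`, `L'` be the fields cut out by …"): for an OPEN normal subgroup `N ≤ Γ_K` of the
absolute Galois group of a perfect field, the fixed field `L₀ = K̄^N` is a finite Galois
subextension of `K̄/K` with `Gal(K̄/L₀) = N` on the nose, in all three spellings of the tree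
(`IntermediateField.fixingSubgroup`, `LocalWeilDatum.galFixing`, `absGaloisFixingSubgroup`).
-/

noncomputable section

open Field IntermediateField

universe u

namespace Literature.NumberTheory.GaloisRepresentations

variable (K : Type u) [Field K] [PerfectField K]

/-- **The fixed field of an open normal subgroup `N ≤ Γ_K` is Galois over `K` with group of
automorphisms of `K̄` over it exactly `N`** (Krull: open ⟹ closed; Mathlib
`InfiniteGalois.fixingSubgroup_fixedField`, `InfiniteGalois.normal_iff_isGalois`).
[cite: NeukirchANT1999, Ch. IV §1] -/
theorem exists_isGalois_galFixing_eq (N : Subgroup (absoluteGaloisGroup K)) [hN : N.Normal]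
    (hNo : IsOpen (N : Set (absoluteGaloisGroup K))) :
    ∃ L₀ : IntermediateField K (AlgebraicClosure K), IsGalois K L₀ ∧
      LocalWeilDatum.galFixing K L₀ = N := by
  haveI : IsGalois K (AlgebraicClosure K) := {}
  let N' : ClosedSubgroup (AlgebraicClosure K ≃ₐ[K] AlgebraicClosure K) :=
    { N with isClosed' := Subgroup.isClosed_of_isOpen N hNo }
  have hfix : (fixedField (N : Subgroup (AlgebraicClosure K ≃ₐ[K] AlgebraicClosure K))).fixingSubgroup
      = N := InfiniteGalois.fixingSubgroup_fixedField N'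
  refine ⟨fixedField (N : Subgroup (AlgebraicClosure K ≃ₐ[K] AlgebraicClosure K)), ?_, ?_⟩
  · rw [← InfiniteGalois.normal_iff_isGalois, hfix]
    exact hN
  · ext σ
    rw [LocalWeilDatum.galFixing, Subgroup.mem_comap, hfix]
    rfl

/-- The same in the `absGaloisFixingSubgroup` spelling used by the cohomological lemmas
(`galoisCohomology.res`, Sah): an open normal `N ≤ Γ_K` is `Gal(K̄/L₀)` for a Galois subextension
`L₀`. [cite: NeukirchANT1999, Ch. IV §1] -/
theorem exists_isGalois_absGaloisFixingSubgroup_eq (N : Subgroup (absoluteGaloisGroup K)) [N.Normal]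
    (hNo : IsOpen (N : Set (absoluteGaloisGroup K))) :
    ∃ (L₀ : IntermediateField K (AlgebraicClosure K)) (h : IsGalois K L₀),
      @absGaloisFixingSubgroup K _ L₀ h.to_normal = N := by
  obtain ⟨L₀, hL, hfix⟩ := exists_isGalois_galFixing_eq K N hNo
  haveI := hL
  exact ⟨L₀, hL, (galFixing_eq_absGaloisFixingSubgroup L₀).symm.trans hfix⟩

end Literature.NumberTheory.GaloisRepresentations

end
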